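import Summits.ValiantsHypothesis.ValiantsHypothesis.Theorems.PrincipalMinorColouringBorderBoundedRankTwoDefs
import Summits.ValiantsHypothesis.ValiantsHypothesis.Theorems.PrincipalMinorColouringBorderBoundedRankTwoDenseCountCore

/-!
# Crux `PrincipalMinorColouring.BorderBoundedRankTwo` (stmt-ValiantsHypothesis-21038), line `closure_counting` —
# stub `stub_denseCount` (registered signature, verbatim)

Registered stub 2 of the skeleton `Cruxes/BorderBoundedRankTwo/Lines/closure_counting.lean` (planner val-width-lines-2):
**dense-image counting** — if every vector `c : (Fin k → Bool) → ℂ` lies in the closure of `NFImage k` (the union of the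
images of the Hrubeš–Joglekar normal-form coefficient maps `nfMap k s ι`, `s ≤ 2k`; Theorems-side vocabulary
`…Theorems.BorderBoundedRankTwoClosureCounting` of `PrincipalMinorColouringBorderBoundedRankTwoDefs`, verbatim the
skeleton's), then `2 ^ k ≤ 1 + (2·(2k))²`.

The proof is the definition-free core `two_pow_le_of_dense_normalFormImages` of
`PrincipalMinorColouringBorderBoundedRankTwoDenseCountCore` (closure-robust Hrubeš–Joglekar 2025 Thm. 2: nonzero
polynomial annihilators of the finitely many images, `exists_aeval_eq_zero_of_card_lt`; their product has a closed zero
set containing the dense union; `MvPolynomial.funext`), whose hypothesis is this one with `monB`, `nfMap`, `NFImage`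
unfolded — the two agree definitionally.

Prover seat val-width-21038-p2 g0 (cell val-width). Definition-free; closes NO item (`--supports stmt-ValiantsHypothesis-21038`,
stub credit `stub_denseCount`). WHAT THIS IS NOT: not `stub_transport`, not the crux; VP ≠ VNP is not moved.
-/

-- `Summit.ValiantsHypothesis.ValiantsHypothesis.…` is the tree's mandated single-conjunct layout (Sub = Summit).
set_option linter.dupNamespace false

namespace Summit.ValiantsHypothesis.ValiantsHypothesis.Theorems.BorderBoundedRankTwoClosureCounting

/-- **Stub 2 (M) — dense-image counting** (line `closure_counting`, crux `BorderBoundedRankTwo`,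
stmt-ValiantsHypothesis-21038; registered signature verbatim). A finite union of images of polynomial maps with at
most `1 + (4k)²` parameters whose closure is all of `ℂ^{2^k}` forces `2^k ≤ 1 + (4k)²`.
[cite: HrubesJoglekar2025, Thm. 2 (p. 53:4)] -/
theorem stub_denseCount :
    ∀ k : ℕ, (∀ c : (Fin k → Bool) → ℂ, c ∈ closure (NFImage k)) → 2 ^ k ≤ 1 + (2 * (2 * k)) ^ 2 :=
  fun k h =>
    Summit.ValiantsHypothesis.ValiantsHypothesis.Theorems.PrincipalMinorColouring.ClosureCounting.two_pow_le_of_dense_normalFormImages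
      k h

end Summit.ValiantsHypothesis.ValiantsHypothesis.Theorems.BorderBoundedRankTwoClosureCounting
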